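import Literature.Topology.FourManifolds.DehnSurgeryTubularUniqueness
import Literature.Topology.FourManifolds.LinkSurgeryFramedUniqueness
import Literature.Topology.FourManifolds.LinkTubularNbhd
import Literature.Topology.FourManifolds.DehnSurgeryTwistProofs
import HarnessLib

/-!
# Framed tubular neighbourhoods of a link agree on their unit tubes after an ambient diffeomorphism

Topic `Literature/Topology/FourManifolds`. Link version of the tree's
`Knot.TubularNbhd.exists_diffeomorph_eq_of_hasFraming` (`DehnSurgeryTubularUniqueness.lean`), and
its consequences for surgery presentations; everything here is proved and no definition or named
fact is introduced. It removes the named fact (B) `Knot.TubularNbhd.framedUniqueness`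
(`KirbyMovesBlowDown.lean`) from the reductions of the leaves (B) blow-down and (H) handle slide of
Kirby's theorem (`KirbyMovesFromModels.lean`).

**Theorem** (`Literature.Topology.FourManifolds.Link.exists_diffeomorph_eq_of_hasFraming`). Let
`L` be a link in `S³` with finitely many components and `ν`, `ν'` two families of oriented
tubular neighbourhoods of its components (`Knot.TubularNbhd`, orientation convention `det_pos`),
each with pairwise disjoint images, with the same framing integers: `(ν i).HasFraming (m i)`,
`(ν' i).HasFraming (m i)`. Then there is a diffeomorphism `F` of `S³` fixing every component
pointwise with `F (ν i (x, w)) = ν' i (x, w)` for all `i`, `x ∈ S¹`, `‖w‖ < 1`.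

This is the uniqueness of tubular neighbourhoods of a compact submanifold up to ambient isotopy
and an isometry of the fibres (Kosinski, *Differential Manifolds* (1993), Ch. III, Thm. (3.5);
Hirsch, *Differential Topology* (1976), Ch. 4 §5 Thm. 5.3 with Ch. 8 §1 Thm. 1.3), sharpened by the
framing hypothesis (Gompf–Stipsicz (1999), §4.5; Rolfsen (1976), §9.F), exactly as in the knot case
of `DehnSurgeryTubularUniqueness.lean`, all components being treated at once:

1. the tree's `Link.exists_diffeomorph_tubularNbhd_rotate` (`LinkTubularUntwist.lean`): a
   diffeomorphism `ψ` fixing `L`, `0 < r ≤ 1` and integers `dᵢ` with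
   `ψ (νᵢ (e^{iθ}, w)) = ν'ᵢ (e^{iθ}, R(dᵢ θ) w)` for `‖w‖ < r`;
2. the degrees vanish (`Knot.TubularNbhd.HasFraming.eq_sub_of_rotate_smul`,
   `LinkSurgeryFramedUniqueness.lean`: `dᵢ` is the difference of the framing integers), after
   precomposing `ψ` with the fibre contraction by `r/2` along the `νᵢ`;
3. from the tube of radius `r` to the unit tube: conjugate by the simultaneous fibre contractions
   `w ↦ (r/2) w` along the `νᵢ`, resp. `ν'ᵢ`, pushed into `S³`
   (`Link.exists_diffeomorph_contract`: `Knot.TubularNbhd.pushforwardDiffeo` of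
   `contractDiffeo`, identity off the tubes, composed over the components).

Consequences (§2): a surgery presentation is transported along such an `F`
(`Link.IsSurgeryPresentation.transport_eq`); hence a surgery presentation can be re-presented with
tubes of the same framings inside any prescribed neighbourhoods of the components and inside the
old tubes (`Link.IsSurgeryPresentation.exists_small_tubes`, the statement (A″)
`Link.IsSurgeryPresentation.shrinkRange_of_framedUniqueness` of `KirbyMovesHandleSlide.lean`
without its hypothesis (B)).

## References

* A. A. Kosinski, *Differential Manifolds*, Academic Press (1993), Ch. III, Thm. (3.5); Ch. VI §1.
  [cite: Kosinski1993, Ch. III Thm (3.5)]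
* M. W. Hirsch, *Differential Topology*, GTM 33 (1976), Ch. 4 §5 Thm. 5.3, Ch. 8 §1.
  [cite: Hirsch1976, Ch. 4 §5 Thm. 5.3]
* R. E. Gompf, A. I. Stipsicz, *4-Manifolds and Kirby Calculus* (1999), §4.5, §5.3.
  D. Rolfsen, *Knots and Links* (1976), §9.F. [cite: Rolfsen1976, §9.F]
-/

noncomputable section

open Set Function
open scoped Manifold ContDiff Topology

namespace Literature.Topology.FourManifolds

namespace Link

variable {ι : Type*} [Finite ι]

/-! ### Simultaneous fibre contractions -/

/-- **Simultaneous fibre contractions of the tubular neighbourhoods of a link, pushed into `S³`.**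
For oriented tubular neighbourhoods `νᵢ` with pairwise disjoint images and `0 < c ≤ 1` there is a
diffeomorphism `Λ` of `S³` fixing every component pointwise, with `Λ (νᵢ (x, w)) = νᵢ (x, c • w)`
for `‖w‖ ≤ 7/2`, and equal to the identity off `⋃ᵢ νᵢ (S¹ × ℝ²)`: the composite over the
components of the push-forwards (`Knot.TubularNbhd.pushforwardDiffeo`) of the compactly supported
contraction `contractDiffeo` of the fibre (as in the tree's one-knot
`Knot.TubularNbhd.exists_diffeomorph_contract`), which have pairwise disjoint supports. Kosinski
(1993), VI.1, proof of (1.1) (passing to proper sub-tubes); Hirsch (1976), Ch. 8 §1 (extension by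
the identity). [cite: Kosinski1993, Ch. III Thm (3.5)] -/
theorem exists_diffeomorph_contract (L : Link ι) (ν : ∀ i, Knot.TubularNbhd (L.component i))
    (hdisj : Pairwise fun i j ↦ Disjoint (range (ν i)) (range (ν j))) {c : ℝ} (hc : 0 < c)
    (hc1 : c ≤ 1) :
    ∃ Λ : (Metric.sphere (0 : EuclideanSpace ℝ (Fin 4)) 1) ≃ₘ⟮𝓡 3, 𝓡 3⟯
        (Metric.sphere (0 : EuclideanSpace ℝ (Fin 4)) 1),
      (∀ i x, Λ (L.component i x) = L.component i x) ∧
      (∀ i x (w : EuclideanSpace ℝ (Fin 2)), ‖w‖ ≤ 7 / 2 → Λ (ν i (x, w)) = ν i (x, c • w)) ∧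
      ∀ y, y ∉ (⋃ i, range (ν i)) → Λ y = y := by
  classical
  -- the fibrewise contraction of `S¹ × ℝ²`, supported in the tube of radius `4`
  let Θ := (Diffeomorph.refl (𝓡 1) (Metric.sphere (0 : EuclideanSpace ℝ (Fin 2)) 1) ∞).prodCongr
    (contractDiffeo (E := EuclideanSpace ℝ (Fin 2)) (ρ := 1) one_pos c)
  have hΘ : ∀ p : (Metric.sphere (0 : EuclideanSpace ℝ (Fin 2)) 1) × EuclideanSpace ℝ (Fin 2),
      Θ p = (p.1, contractDiffeo (ρ := 1) one_pos c p.2) := fun p ↦ by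
    obtain ⟨x, w⟩ := p
    rfl
  have hΘsupp : ∀ p : (Metric.sphere (0 : EuclideanSpace ℝ (Fin 2)) 1) × EuclideanSpace ℝ (Fin 2),
      4 ≤ ‖p.2‖ → Θ p = p := fun p hp ↦ by
      rw [hΘ, contractDiffeo_of_le_norm one_pos c (by simpa using hp)]
  have hΘc : ∀ (x : Metric.sphere (0 : EuclideanSpace ℝ (Fin 2)) 1) (w : EuclideanSpace ℝ (Fin 2)),
      ‖w‖ ≤ 7 / 2 → Θ (x, w) = (x, c • w) := fun x w hw ↦ by
    rw [hΘ, contractDiffeo_of_norm_le one_pos hc hc1 (by simpa using hw)]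
  -- compose the push-forwards over a finite set of components
  haveI := Fintype.ofFinite ι
  suffices key : ∀ s : Finset ι, ∃ Λ : (Metric.sphere (0 : EuclideanSpace ℝ (Fin 4)) 1) ≃ₘ⟮𝓡 3, 𝓡 3⟯
      (Metric.sphere (0 : EuclideanSpace ℝ (Fin 4)) 1),
      (∀ i ∈ s, ∀ p, Λ (ν i p) = ν i (Θ p)) ∧ ∀ y, y ∉ (⋃ i ∈ s, range (ν i)) → Λ y = y by
    obtain ⟨Λ, hΛ, hΛoff⟩ := key Finset.univ
    refine ⟨Λ, fun i x ↦ ?_, fun i x w hw ↦ ?_, fun y hy ↦ hΛoff y (by simpa using hy)⟩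
    · rw [← (ν i).coe_apply_zero x, hΛ i (Finset.mem_univ i), hΘ]
      simp
    · rw [hΛ i (Finset.mem_univ i), hΘc x w hw]
  intro s
  induction s using Finset.induction_on with
  | empty => exact ⟨Diffeomorph.refl (𝓡 3) _ ∞, fun i hi ↦ absurd hi (Finset.notMem_empty i),
      fun y _ ↦ rfl⟩
  | insert a s ha ih =>
    obtain ⟨Λ, hΛ, hΛoff⟩ := ih
    refine ⟨Λ.trans ((ν a).pushforwardDiffeo Θ hΘsupp), fun i hi p ↦ ?_, fun y hy ↦ ?_⟩
    · rw [Diffeomorph.coe_trans, comp_apply]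
      rcases Finset.mem_insert.1 hi with rfl | hi'
      · -- the new component: `Λ` is the identity on its tube
        rw [hΛoff (ν i p), Knot.TubularNbhd.pushforwardDiffeo_apply]
        simp only [mem_iUnion, not_exists]
        intro k hk hp
        exact Set.disjoint_left.1 (hdisj (ne_of_mem_of_not_mem hk ha).symm) (mem_range_self p) hp
      · -- an old component: the new push-forward is the identity on its tube
        rw [hΛ i hi' p, Knot.TubularNbhd.pushforwardDiffeo_of_not_mem]
        exact fun h ↦ Set.disjoint_left.1 (hdisj (ne_of_mem_of_not_mem hi' ha)) (mem_range_self _) h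
    · simp only [mem_iUnion, not_exists, Finset.mem_insert] at hy
      rw [Diffeomorph.coe_trans, comp_apply, hΛoff y, Knot.TubularNbhd.pushforwardDiffeo_of_not_mem]
      · exact fun h ↦ hy a (Or.inl rfl) h
      · simp only [mem_iUnion, not_exists]
        exact fun k hk ↦ hy k (Or.inr hk)

/-! ### Framed tubular neighbourhoods of a link agree on the unit tubes -/

/-- **Two families of oriented tubular neighbourhoods of a link with the same framings agree, on
the unit disc bundles, after an ambient diffeomorphism fixing the link.** For a link `L` in `S³`
with finitely many components and oriented tubular neighbourhoods `νᵢ`, `ν'ᵢ` (each family with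
pairwise disjoint images) with `(ν i).HasFraming (m i)` and `(ν' i).HasFraming (m i)`, there is a
diffeomorphism `F` of `S³` with `F ∘ Kᵢ = Kᵢ` and `F (νᵢ (x, w)) = ν'ᵢ (x, w)` for `‖w‖ < 1`, all
`i`. Uniqueness of tubular neighbourhoods up to ambient isotopy and a rotation field
(`Link.exists_diffeomorph_tubularNbhd_rotate`; Kosinski (1993), III, Thm. (3.5)), the degrees of
the rotation fields being differences of framing integers
(`Knot.TubularNbhd.HasFraming.eq_sub_of_rotate_smul`), hence zero, and fibre contractions to pass
from the tube of radius `r` to the unit tube (`Link.exists_diffeomorph_contract`). Gompf–Stipsicz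
(1999), §4.5, §5.3; Rolfsen (1976), §9.F. [cite: Kosinski1993, Ch. III Thm (3.5)] -/
theorem exists_diffeomorph_eq_of_hasFraming (L : Link ι)
    (ν ν' : ∀ i, Knot.TubularNbhd (L.component i))
    (hdisj : Pairwise fun i j ↦ Disjoint (range (ν i)) (range (ν j)))
    (hdisj' : Pairwise fun i j ↦ Disjoint (range (ν' i)) (range (ν' j))) {m : ι → ℤ}
    (hfr : ∀ i, (ν i).HasFraming (m i)) (hfr' : ∀ i, (ν' i).HasFraming (m i)) :
    ∃ F : (Metric.sphere (0 : EuclideanSpace ℝ (Fin 4)) 1) ≃ₘ⟮𝓡 3, 𝓡 3⟯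
        (Metric.sphere (0 : EuclideanSpace ℝ (Fin 4)) 1),
      (∀ i x, F (L.component i x) = L.component i x) ∧
      ∀ i x (w : EuclideanSpace ℝ (Fin 2)), ‖w‖ < 1 → F (ν i (x, w)) = ν' i (x, w) := by
  -- Step 1: agreement up to rotation fields of integer degrees, on tubes of radius `r`
  obtain ⟨ψ, hψL, r, hr, hr1, d, hψν⟩ := L.exists_diffeomorph_tubularNbhd_rotate ν ν' hdisj hdisj'
  -- the fibre contractions by `c = r / 2`
  have hc : 0 < r / 2 := by positivity
  have hc1 : r / 2 ≤ 1 := by linarith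
  obtain ⟨Λ, hΛL, hΛν, -⟩ := L.exists_diffeomorph_contract ν hdisj hc hc1
  obtain ⟨Λ', hΛ'L, hΛ'ν, -⟩ := L.exists_diffeomorph_contract ν' hdisj' hc hc1
  -- Step 2: the degrees vanish
  have hd : ∀ i, d i = 0 := fun i ↦ by
    have hg : Continuous (ψ ∘ Λ) := ψ.continuous.comp Λ.continuous
    have hgK : MapsTo (ψ ∘ Λ) (range ⇑(L.component i))ᶜ (range ⇑(L.component i))ᶜ := by
      rintro y hy ⟨x, hx⟩
      apply hy
      refine ⟨x, ?_⟩
      rw [comp_apply] at hx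
      have h1 : ψ (Λ (L.component i x)) = ψ (Λ y) := by rw [hΛL, hψL, hx]
      exact Λ.injective (ψ.injective h1)
    have key := Knot.TubularNbhd.HasFraming.eq_sub_of_rotate_smul (hfr i) (hfr' i) hg hgK (d i)
      hc hc1 fun θ w hw ↦ ?_
    · omega
    · rw [comp_apply, hΛν i _ w (by linarith), hψν i θ _ ?_, rotPlane_smul]
      rw [norm_smul, Real.norm_of_nonneg hc.le]
      nlinarith
  have hψν' : ∀ i x (w : EuclideanSpace ℝ (Fin 2)), ‖w‖ < r → ψ (ν i (x, w)) = ν' i (x, w) :=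
      fun i x w hw ↦ by
    obtain ⟨θ, rfl⟩ := circlePoint_surjective x
    rw [hψν i θ w hw, hd i, Int.cast_zero, zero_mul, rotPlane_zero]
  -- Step 3: conjugate by the contractions
  refine ⟨Λ.trans (ψ.trans Λ'.symm), fun i x ↦ ?_, fun i x w hw ↦ ?_⟩
  · rw [Diffeomorph.coe_trans, Diffeomorph.coe_trans, comp_apply, comp_apply, hΛL, hψL]
    conv_lhs => rw [← hΛ'L i x]
    exact Λ'.symm_apply_apply _
  · have hcw : ‖(r / 2) • w‖ < r := by
      rw [norm_smul, Real.norm_of_nonneg hc.le]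
      nlinarith
    rw [Diffeomorph.coe_trans, Diffeomorph.coe_trans, comp_apply, comp_apply,
      hΛν i x w (by linarith), hψν' i x _ hcw, ← hΛ'ν i x w (by linarith)]
    exact Λ'.symm_apply_apply _

/-! ### Consequences for surgery presentations -/

variable {EY HY : Type*} [NormedAddCommGroup EY] [NormedSpace ℝ EY] [TopologicalSpace HY]
  {IY : ModelWithCorners ℝ EY HY} {Y : Type*} [TopologicalSpace Y] [ChartedSpace HY Y]

/-- **Transport of a surgery presentation along a diffeomorphism of `S³` matching the tubes.** If
`Y` is presented as surgery on `L` with the tubes `ν`, and a diffeomorphism `F` of `S³` fixes every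
component pointwise and conjugates the open unit tube of each `ν i` onto that of `ν' i`, then `Y`
is presented with the tubes `ν'`: precompose the embedding of the link complement with `F⁻¹`, keep
the solid tori (all-components form of `Link.IsSurgeryPresentation.transport_update`,
`KirbyMovesHandleSlide.lean`). Rolfsen (1976), §9.F. [cite: Rolfsen1976, §9.F] -/
theorem IsSurgeryPresentation.transport_eq {L : Link ι}
    {ν ν' : ∀ i, Knot.TubularNbhd (L.component i)} (hpres : L.IsSurgeryPresentation IY Y ν)
    (F : (Metric.sphere (0 : EuclideanSpace ℝ (Fin 4)) 1) ≃ₘ⟮𝓡 3, 𝓡 3⟯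
      (Metric.sphere (0 : EuclideanSpace ℝ (Fin 4)) 1))
    (hfix : ∀ i x, F (L.component i x) = L.component i x)
    (hconj : ∀ i x (w : EuclideanSpace ℝ (Fin 2)), ‖w‖ < 1 → F (ν i (x, w)) = ν' i (x, w)) :
    L.IsSurgeryPresentation IY Y ν' := by
  obtain ⟨jA, jB, hA, hAo, hB, hcov, hBdisj, hglue⟩ := hpres
  refine ⟨jA ∘ Link.complDiffeoSymm F L hfix, jB, isSmoothEmbedding_comp_diffeomorph hA _, ?_,
    hB, ?_, hBdisj, fun i a b ↦ ?_⟩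
  · rw [Link.range_comp_complDiffeoSymm]; exact hAo
  · rw [Link.range_comp_complDiffeoSymm]; exact hcov
  rw [comp_apply, hglue i]
  change (ν i).glueRel (F.symm a) b ↔ (ν' i).glueRel a b
  constructor
  · rintro ⟨u, t, ht, hb, ha⟩
    refine ⟨u, t, ht, hb, ?_⟩
    have := congrArg F ha
    rwa [Diffeomorph.apply_symm_apply, hconj i u _ (norm_smul_coe_sphere_lt_one ht _)] at this
  · rintro ⟨u, t, ht, hb, ha⟩
    refine ⟨u, t, ht, hb, ?_⟩
    rw [ha, ← hconj i u _ (norm_smul_coe_sphere_lt_one ht _), Diffeomorph.symm_apply_apply]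

/-- **Re-presenting a surgery with tubes of small images** (the statement (A″)
`Link.IsSurgeryPresentation.shrinkRange_of_framedUniqueness` of `KirbyMovesHandleSlide.lean`,
without its hypothesis (B)). If `Y` (any model) is presented as surgery on `L` with oriented
tubular neighbourhoods `νᵢ` of framings `mᵢ` and pairwise disjoint images, then for any open
`Vᵢ ⊇ Kᵢ(S¹)` it is also presented with oriented tubular neighbourhoods `ν'ᵢ` of the same framings
whose whole images lie in `Vᵢ` and in the images of the `νᵢ` (so they are again pairwise
disjoint): small tubes of the right framings exist (`Knot.exists_tubularNbhd_range_subset`,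
`Knot.TubularNbhd.exists_hasFraming_range_eq`), the two families agree on the unit tubes after a
diffeomorphism of `S³` fixing `L` (`Link.exists_diffeomorph_eq_of_hasFraming`), and the
presentation is transported along it (`transport_eq`). The surgery only depends on the germ of the
tubes along the link (Rolfsen (1976), §9.F: a tubular neighbourhood "of any radius"; Kosinski
(1993), III.(3.4)). [cite: Rolfsen1976, §9.F] -/
theorem IsSurgeryPresentation.exists_small_tubes {L : Link ι} {m : ι → ℤ}
    {ν : ∀ i, Knot.TubularNbhd (L.component i)} (hν : ∀ i, (ν i).HasFraming (m i))
    (hdisj : Pairwise fun i j ↦ Disjoint (range (ν i)) (range (ν j)))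
    (h : L.IsSurgeryPresentation IY Y ν)
    (V : ι → Set (Metric.sphere (0 : EuclideanSpace ℝ (Fin 4)) 1)) (hV : ∀ i, IsOpen (V i))
    (hKV : ∀ i, range (L.component i) ⊆ V i) :
    ∃ ν' : ∀ i, Knot.TubularNbhd (L.component i), (∀ i, (ν' i).HasFraming (m i)) ∧
      (∀ i, range (ν' i) ⊆ V i) ∧ (∀ i, range (ν' i) ⊆ range (ν i)) ∧
      L.IsSurgeryPresentation IY Y ν' := by
  -- small tubes of the right framings
  have key : ∀ i, ∃ ν₂ : Knot.TubularNbhd (L.component i), ν₂.HasFraming (m i) ∧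
      range ν₂ ⊆ V i ∩ range (ν i) := fun i ↦ by
    have hopen : IsOpen (V i ∩ range ⇑(ν i)) := (hV i).inter (ν i).isOpenMap.isOpen_range
    obtain ⟨ν₀, hν₀⟩ := (L.component i).exists_tubularNbhd_range_subset hopen
      (subset_inter (hKV i) (ν i).range_subset_range)
    obtain ⟨ν₂, hrange₂, hfr₂⟩ := ν₀.exists_hasFraming_range_eq (m i)
    exact ⟨ν₂, hfr₂, hrange₂ ▸ hν₀⟩
  choose ν₂ hfr₂ hrange₂ using key
  have hdisj₂ : Pairwise fun i j ↦ Disjoint (range (ν₂ i)) (range (ν₂ j)) := fun i j hij ↦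
    (hdisj hij).mono ((hrange₂ i).trans inter_subset_right)
      ((hrange₂ j).trans inter_subset_right)
  obtain ⟨F, hFL, hFν⟩ := L.exists_diffeomorph_eq_of_hasFraming ν ν₂ hdisj hdisj₂ hν hfr₂
  exact ⟨ν₂, hfr₂, fun i ↦ (hrange₂ i).trans inter_subset_left,
    fun i ↦ (hrange₂ i).trans inter_subset_right, h.transport_eq F hFL hFν⟩

end Link

end Literature.Topology.FourManifolds
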